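import Summits.NavierStokesRegularity.NavierStokesRegularity.Theses.PerpetualPump
import Summits.NavierStokesRegularity.NavierStokesRegularity.Theorems.CircuitTrace.Negative.LoadBearing
import HarnessLib.Audit

/-!
# Line `quiet-valve-budget` ("trail-and-valve") for crux `PerpetualPump.CircuitTrace` (stmt-NavierStokesRegularity-1836)

Skeleton (crux-plan, planner-cruxplan-stmt-NavierStokesRegularity-1836-quiet-valve-budget-0, 2026-08-16) from
crux idea card `Cruxes/CircuitTrace/Ideas/quiet-valve-budget.md` (ideator 3, round 1) planned, as the card's
`Transfer:` and all three triagers (r1-1/2/3: PASS ×3, "recommended pick: ONE skeleton trail-and-valve") ask, as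
ONE line with its companion card `clock-discounted-trail-mass.md` (same ideator). POSITIVE line (the crux is
expected TRUE; `Disproof.lean` v3: "NO KILL; very probably holds").

`CircuitTrace_of : Theses.PerpetualPump.CircuitTrace` (the five sorried `stub_*` fed to the sorry-free
`circuitTrace_of_parts`, transported along the landed `circuitTrace_iff : CircuitTrace ↔ CircuitTrace'`, `Iff.rfl`)
concludes the route decl `Summit.NavierStokesRegularity.NavierStokesRegularity.Theses.PerpetualPump.CircuitTrace`
BY NAME — the unique `#h21_check_skeleton` candidate (closed = false until the stubs land). `lean check`: rc 0,
sorries = the five `stub_*` only. Stub statements are written FULLY UNFOLDED (Mathlib + the landed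
`Negative.LoadBearing.circuitRHS` / `IsCyclic` only), so each lands as a `kind=proof` helper by name + signature.

## SHARED STUBS — read this first (lead prover)

Three of the five stubs — `stub_valveBudget`, `stub_blockStaysQuiet`, `stub_quietImpliesRegular` — are, BY DESIGN,
character-for-character the statements the lead registered on the crux from its reshaped `tilted-trace-gronwall`
skeleton (skeleton da3ad81a3111, 2026-08-16T02:21:40Z; they are tilted-trace's S1/S2a/S2b, which tilted-trace took from
THIS card's `ValveBudget` / `QuietBlockRegular`). One proof of each serves both lines. What this line CHANGES is the
`ℓ³` endgame and the glue: instead of `stub_tiltedGronwall + stub_terminalTrace + stub_traceEndgame` (trace at `T⁻`,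
Toeplitz) it needs `stub_trailGronwall` (the companion's CLOCK-DISCOUNTED TRAIL MASS Grönwall, M, no cancellation, no
a-priori bound) + `stub_lateSparsity` (LATE ACTIVITY IS SPARSE: coefficient-free counting, M−), and its sorry-free glue
needs NO synchrony / pace statement, no `sSup`, no limit at `T⁻`: one EARLY-RETIRED SCALE found by pigeonhole is a quiet
valve on its final window, and the valve dichotomy finishes (`regular_of_earlyRetiredScale`, the card's Transfer
`C⁺ ⇒ crux`, PROVED here). To switch endgames the lead keeps its three shared stubs and swaps in the two new ones.

## Units

`a_{i,n}(t) := lam^{n/5}|X_{i,n}(t)|` is the critical (scale-invariant) amplitude; the CLOCK of scale `n` runs at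
rate `lam^{4n/5}` (its dissipation rate). In clock units the four monomials of `Ẋ_{i,n}` (offsets
`S = {0,e₁,e₂,e₃}` ↔ `none, some 0, some 1, some 2`) carry `a_n a_n · 1`, `a_{n+1}a_n · lam^{-1/5}` (twice),
`a_{n-1}² · lam^{-3/5}`: every monomial driving scale `n` has a factor at a scale `≤ n` (ONE-SIDED COUPLING, landed
`Negative.Structure.circuitRHS_eq_zero_of_vanishing_below`), and the only energy-carrying triad across the cut
`n | n+1` is `{n,n,n+1}` (landed `Negative.Structure.trilinear_cancel`).

## The line in one paragraph

VALVE (this card; F2 + F3 of the Disproof): while a scale `n` is `δ`-QUIET and the block above it `δ`-ACTIVE, the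
critical block energy `ℰ_n = lam^{2(n+1)/5} Σ_{j>n}‖X_j‖² ≤ C(A)` burns at rate `≥ δ²` per `(n+1)`-clock unit, the cubic
leak `2K m^{5/2} lam^{-3/5} δ² |a_{n+1}|` through the quiet valve being absorbed by `a_{n+1}`'s OWN dissipation
(`stub_valveBudget`, S-V, HARDEST); a quiet block above a quiet valve stays `2δ`-quiet (`stub_blockStaysQuiet`, S-Q1,
sup-norm maximum principle) and a quiet half-line is `H¹⁰`-bounded (`stub_quietImpliesRegular`, S-Q2, weighted maximum
principle + one Duhamel step). Hence (PROVED, `regular_of_earlyRetiredScale`): if some scale `n ≥ 0` has NO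
`δ`-exceedance during a final window `[T − w, T)` with `δ² lam^{4(n+1)/5} w > 2C`, the solution is regular — either
the block above `n` is `δ`-quiet at some instant of the window (Q1 + Q2), or it is active throughout and V on
`[T − w, T − w/2]` says the window is shorter than it is. TRAIL (companion card; F1 of the Disproof): the
clock-discounted trail mass `H_j(t) = Σ_{k≤j} Σ_i lam^{θ(k−j)} a_{i,k}(t)³` obeys the FORWARD Grönwall inequality
`H_j(t) ≥ e^{−L lam^{4j/5}(t−s)} H_j(s)` (`stub_trailGronwall`, S-T: mass below a scale cannot be emptied faster than
that scale's own clock), so a `δ`-exceedance at scale `j` within `K` own-clock units of `T` deposits `≥ e^{−LK}δ³`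
for ever, and summing the `H_j` of distinct scales at ONE later time against `‖a(t)‖³_{ℓ³}/(1 − lam^{−θ}) ≤ M/(1−lam^{−θ})`
bounds the NUMBER of late-active scales by `N(lam,θ,M,L,δ,K)` (`stub_lateSparsity`, S-L — the only place `ℓ³` is
used). GLUE (PROVED, `circuitTrace_of_parts`): `A := max M 1`; `δ := min δ₀ (min δ₁ (ε₀/2))`;
`K := 2·max C 0/(δ² lam^{4/5}) + 1`; among the `N+1` consecutive scales `n₀, …, n₀+N` (`K lam^{−4n₀/5} < T`) one is not
late-active (pigeonhole), i.e. `δ`-quiet on its final window of length `w = K lam^{−4n/5}`, and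
`δ² lam^{4(n+1)/5} w = δ² lam^{4/5} K > 2·max C 0`: `regular_of_earlyRetiredScale` concludes. No limit object, no
backward uniqueness, no compactness, no pace theorem.

## Registered stubs (5)

* S-T  `stub_trailGronwall` — M. Companion card's `TraceInequality` (lever (a)/F1). NEW w.r.t. the registry.
* S-L  `stub_lateSparsity` — M−. Companion card's `LateActivitySparse`, GIVEN the trail inequality (pure real
  analysis: no ODE, no `coeff`). NEW. The ONLY stub using the `ℓ³` hypothesis.
* S-V  `stub_valveBudget` — L, HARDEST. This card's `ValveBudget` (F2), `ℓ^∞` form. SHARED (= lead's, verbatim).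
* S-Q1 `stub_blockStaysQuiet` — M−. This card's `QuietBlockRegular` (MP1). SHARED (= lead's, verbatim).
* S-Q2 `stub_quietImpliesRegular` — M. This card's `QuietBlockRegular` (MP2 + Duhamel). SHARED (= lead's, verbatim).

Proved here (no stub): `critSup_of_l3` (`ℓ³ ⇒ sup a ≤ max M 1`), `exists_window_lt` (own-clock windows shrink),
`regular_of_earlyRetiredScale` (Transfer `C⁺ ⇒ Regular`), `exists_earlyRetiredScale` (pigeonhole from S-L),
`circuitTrace_of_parts`, `CircuitTrace_of`.

## Disproof / negatives / triage honoured

* `Cruxes/CircuitTrace/Disproof.lean` v3 (cdisprove; read 2026-08-16T02:30Z) and the landed, importable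
  `Theorems/CircuitTrace/Negative/LoadBearing.lean` (p73393, imported here) + `Negative/Structure.lean` (p74903):
  `circuitTrace_false_without_apriori` — the a-priori `H¹⁰` bound `H` is load-bearing: this line USES `H` at S-V
  (finite-block energies telescope and the top flux `π_N → 0`, or termwise differentiation of the tail series, on
  `[t₁,t₂]`, `t₂ < T`), at S-Q1 (the block sup is a max: `a_j ≤ C_{T'} lam^{−19j/5}`), at S-Q2 (weight `4−ε` sup is a
  max; finiteness at `t₁`; `[0,t₁]` covered by `H`); S-T and S-L do not need it and prove nothing `H¹⁰` by themselves.
  `circuitTraceWithoutL3_false` (mod `MaximalH10Solutions`) — `ℓ³` is load-bearing: used exactly once, in S-L; the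
  four other stubs are `ℓ^∞`-tier facts that hold along the Type-I facet witness and the conjectured `CircuitPump`,
  consistent with `CircuitTraceLinfty` expected FALSE. No stub is an instance of `CircuitTraceWithoutApriori`,
  `CircuitTraceWithoutL3`, `CircuitTraceLinfty`. Disproof §6 "ValveBudget constant shape suspect": answered inside
  S-V's docstring (the `(n+1)`-dissipation absorbs the valve leak: `−2x² + 2rδ²x ≤ r²δ⁴/2`), as the lead and the three
  triagers also found (0 violations; worst `dℰ/dτ = −2.89δ²`).
* `ledger negatives --problem NavierStokesRegularity` (2026-08-16): stmt-0154, stmt-4055 — PDE-level, unrelated.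
* Triage r1-1 "adopt the cubic/discounted packaging; guard m = 0 / sign vacuity": S-T/S-L are the cubic discounted
  trail mass; every stub is true or vacuous at `m = 0`, `A < 0`, `M < 0` (checked by hand, line card). r1-2 "SYNCHRONY
  deserves its own stub; fix one amplitude convention": per-mode amplitudes `lam^{n/5}|X_{i,n}|` throughout; synchrony
  is NOT needed by this glue (one early-retired scale suffices) and is already registered as tilted-trace's
  `SynchronyStmt`/cold-gap's `Synchrony` (both provable from S-V + S-Q1 + S-Q2) — not duplicated here. r1-3
  "`IsSymmCoeff` unused": dropped from every stub (S-V keeps `IsCyclic` only). Lead (PICKED.md) "no tsum/HasDerivAt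
  interface; split S2": S-V is the inequality only; S-Q1/S-Q2 are the lead's own split, verbatim.
-/

set_option linter.dupNamespace false

noncomputable section

namespace Summit.NavierStokesRegularity.NavierStokesRegularity.Cruxes.CircuitTrace.QuietValveBudget

open Finset Real Set
open Summit.NavierStokesRegularity.NavierStokesRegularity.Theorems.CircuitTrace.Negative
  (circuitRHS IsSymm IsCyclic CircuitTrace' circuitTrace_iff)

/-! ## Vocabulary (abbreviations used by the sorry-free glue; the stubs are stated unfolded) -/

/-- Tao's circuit ODE (4.3) on `(0,T)` (`circuitRHS` = the crux's inlined `let F`, landed in `Negative.LoadBearing`). -/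
def OdeOn (lam : ℝ) {m : ℕ} (coeff : Fin m → Fin m → Fin m → Option (Fin 3) → ℝ) (T : ℝ)
    (X : Fin m → ℤ → ℝ → ℝ) : Prop :=
  ∀ (i : Fin m) (n : ℤ), ∀ t ∈ Set.Ioo 0 T, HasDerivAt (X i n) (circuitRHS lam coeff X i n t) t

/-- No modes below scale `0` (Tao Lemma 4.1(v) normalisation). -/
def Cutoff {m : ℕ} (X : Fin m → ℤ → ℝ → ℝ) : Prop :=
  ∀ (i : Fin m) (n : ℤ) (t : ℝ), n < 0 → X i n t = 0

/-- The a-priori `H¹⁰` bound on compact sub-intervals (load-bearing: `circuitTrace_false_without_apriori`). -/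
def Apriori (lam : ℝ) {m : ℕ} (T : ℝ) (X : Fin m → ℤ → ℝ → ℝ) : Prop :=
  ∀ T' ∈ Set.Ioo 0 T, ∃ C : ℝ, ∀ (i : Fin m) (n : ℤ), ∀ t ∈ Set.Icc 0 T',
    lam ^ ((4 : ℝ) * n) * |X i n t| ≤ C

/-- `ℓ^∞`-in-scale critical bound `a_{i,n}(t) = lam^{n/5}|X_{i,n}(t)| ≤ A` on `[0,T)` (Type-I tier size information;
from the crux's `ℓ³` bound with `A = max M 1`, `critSup_of_l3`). -/
def CritSup (lam : ℝ) {m : ℕ} (T A : ℝ) (X : Fin m → ℤ → ℝ → ℝ) : Prop :=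
  ∀ t ∈ Set.Ico 0 T, ∀ (i : Fin m) (n : ℤ), lam ^ ((1 / 5 : ℝ) * n) * |X i n t| ≤ A

/-- The crux's `ℓ³`-in-scale critical bound, verbatim (finite partial sums `≤ M`). -/
def CritL3 (lam : ℝ) {m : ℕ} (T M : ℝ) (X : Fin m → ℤ → ℝ → ℝ) : Prop :=
  ∀ t ∈ Set.Ico 0 T, ∀ s : Finset ℤ,
    ∑ n ∈ s, ∑ i : Fin m, (lam ^ ((1 / 5 : ℝ) * n) * |X i n t|) ^ 3 ≤ M

/-- The crux's conclusion, verbatim: the `H¹⁰` weight stays bounded up to `T`. -/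
def Regular (lam : ℝ) {m : ℕ} (T : ℝ) (X : Fin m → ℤ → ℝ → ℝ) : Prop :=
  ∃ C : ℝ, ∀ (i : Fin m) (n : ℤ), ∀ t ∈ Set.Ico 0 T, lam ^ ((4 : ℝ) * n) * |X i n t| ≤ C

/-- CLOCK-DISCOUNTED TRAIL MASS below scale `j` (companion card's lever):
`H_j(t) = Σ_{k=0}^{j} Σ_i lam^{θ(k−j)} a_{i,k}(t)³` — a FINITE sum (no modes below `0`), cubes of the crux's own
`ℓ³` summands, geometrically discounted DOWNWARD from `j`. -/
def trailMass (lam θ : ℝ) {m : ℕ} (X : Fin m → ℤ → ℝ → ℝ) (j : ℕ) (t : ℝ) : ℝ :=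
  ∑ k ∈ Finset.range (j + 1), ∑ i : Fin m,
    lam ^ (θ * ((k : ℝ) - j)) * (lam ^ ((1 / 5 : ℝ) * k) * |X i (k : ℤ) t|) ^ 3

/-- The trail inequality with constant `L` for one solution on `(0,T)`:
`e^{−L lam^{4j/5}(t−s)} H_j(s) ≤ H_j(t)` for `0 < s ≤ t < T`, every `j`. -/
def TrailIneqOn (lam θ L T : ℝ) {m : ℕ} (X : Fin m → ℤ → ℝ → ℝ) : Prop :=
  ∀ (j : ℕ) (s t : ℝ), 0 < s → s ≤ t → t < T →
    Real.exp (-(L * lam ^ ((4 / 5 : ℝ) * j) * (t - s))) * trailMass lam θ X j s ≤ trailMass lam θ X j t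

/-- Scale `j` is LATE-ACTIVE at level `δ`, horizon `K`: some mode of scale `j` has a `δ`-exceedance at a time
`s ∈ (0,T)` within `K` units of ITS OWN clock of `T` (`T − s ≤ K lam^{−4j/5}`). -/
def LateActive (lam : ℝ) {m : ℕ} (T δ K : ℝ) (X : Fin m → ℤ → ℝ → ℝ) (j : ℕ) : Prop :=
  ∃ i : Fin m, ∃ s ∈ Set.Ioo 0 T,
    T - s ≤ K * lam ^ (-((4 / 5 : ℝ) * j)) ∧ δ ≤ lam ^ ((1 / 5 : ℝ) * j) * |X i (j : ℤ) s|

/-- VALVE BUDGET at one circuit, amplitude bound `A`, threshold `δ₀`, budget `C` (this card's `ValveBudget`, `ℓ^∞`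
form): for `0 < δ ≤ δ₀`, a valve scale `n ≥ 0` that is `δ`-QUIET on `[t₁,t₂] ⊂ (0,T)` while at EVERY instant some mode
strictly ABOVE `n` is `δ`-ACTIVE forces `δ² · lam^{4(n+1)/5} · (t₂ − t₁) ≤ C`. -/
def ValveBudgetAt (lam : ℝ) {m : ℕ} (coeff : Fin m → Fin m → Fin m → Option (Fin 3) → ℝ)
    (A δ₀ C : ℝ) : Prop :=
  ∀ δ : ℝ, 0 < δ → δ ≤ δ₀ → ∀ (T : ℝ) (X : Fin m → ℤ → ℝ → ℝ), 0 < T →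
    OdeOn lam coeff T X → Cutoff X → Apriori lam T X → CritSup lam T A X →
    ∀ n : ℤ, 0 ≤ n → ∀ t₁ t₂ : ℝ, 0 < t₁ → t₁ ≤ t₂ → t₂ < T →
      (∀ i : Fin m, ∀ t ∈ Set.Icc t₁ t₂, lam ^ ((1 / 5 : ℝ) * n) * |X i n t| ≤ δ) →
      (∀ t ∈ Set.Icc t₁ t₂, ∃ (i : Fin m) (j : ℤ), n < j ∧ δ ≤ lam ^ ((1 / 5 : ℝ) * j) * |X i j t|) →
      δ ^ 2 * lam ^ ((4 / 5 : ℝ) * (n + 1)) * (t₂ - t₁) ≤ C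

/-- QUIET PERSISTS at one circuit, bound `A`, threshold `δ₁` (MP1): for `0 < δ ≤ δ₁`, a valve `n ≥ 0` that is `δ`-quiet
on `[t₁,T)` with the block above it `δ`-quiet AT `t₁` keeps the block `2δ`-quiet on `[t₁,T)`. -/
def BlockStaysQuietAt (lam : ℝ) {m : ℕ} (coeff : Fin m → Fin m → Fin m → Option (Fin 3) → ℝ)
    (A δ₁ : ℝ) : Prop :=
  ∀ δ : ℝ, 0 < δ → δ ≤ δ₁ → ∀ (T : ℝ) (X : Fin m → ℤ → ℝ → ℝ), 0 < T →
    OdeOn lam coeff T X → Cutoff X → Apriori lam T X → CritSup lam T A X →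
    ∀ n : ℤ, 0 ≤ n → ∀ t₁ ∈ Set.Ioo 0 T,
      (∀ i : Fin m, ∀ t ∈ Set.Ico t₁ T, lam ^ ((1 / 5 : ℝ) * n) * |X i n t| ≤ δ) →
      (∀ (i : Fin m) (j : ℤ), n < j → lam ^ ((1 / 5 : ℝ) * j) * |X i j t₁| ≤ δ) →
      ∀ (i : Fin m) (j : ℤ), n < j → ∀ t ∈ Set.Ico t₁ T, lam ^ ((1 / 5 : ℝ) * j) * |X i j t| ≤ 2 * δ

/-- QUIET HALF-LINE ⇒ REGULAR at one circuit, bound `A`, threshold `ε₀` (MP2 + Duhamel): if every scale `j ≥ n`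
(`n ≥ 0`) is `ε₀`-quiet on a final window `[t₁,T)`, the `H¹⁰` weight is bounded on `[0,T)`. -/
def QuietImpliesRegularAt (lam : ℝ) {m : ℕ} (coeff : Fin m → Fin m → Fin m → Option (Fin 3) → ℝ)
    (A ε₀ : ℝ) : Prop :=
  ∀ (T : ℝ) (X : Fin m → ℤ → ℝ → ℝ), 0 < T →
    OdeOn lam coeff T X → Cutoff X → Apriori lam T X → CritSup lam T A X →
    ∀ n : ℤ, 0 ≤ n → ∀ t₁ ∈ Set.Ioo 0 T,
      (∀ (i : Fin m) (j : ℤ), n ≤ j → ∀ t ∈ Set.Ico t₁ T, lam ^ ((1 / 5 : ℝ) * j) * |X i j t| ≤ ε₀) →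
      ∃ C : ℝ, ∀ (i : Fin m) (j : ℤ), ∀ t ∈ Set.Ico 0 T, lam ^ ((4 : ℝ) * j) * |X i j t| ≤ C

/-! ## The five stub STATEMENTS as named `Prop`s (definitionally the unfolded `stub_*` types below) -/

/-- S-T statement: the TRAIL GRÖNWALL inequality holds with some `L = L(lam,θ,m,coeff,A) ≥ 0`, uniformly in the
solution, for every circuit (no symmetry, NO cancellation, NO a-priori bound needed). -/
def TrailGronwallStmt : Prop :=
  ∀ lam : ℝ, 1 < lam → ∀ θ : ℝ, 0 < θ →
    ∀ (m : ℕ) (coeff : Fin m → Fin m → Fin m → Option (Fin 3) → ℝ) (A : ℝ),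
      ∃ L : ℝ, 0 ≤ L ∧ ∀ (T : ℝ) (X : Fin m → ℤ → ℝ → ℝ),
        OdeOn lam coeff T X → Cutoff X → CritSup lam T A X → TrailIneqOn lam θ L T X

/-- S-L statement: LATE ACTIVITY IS SPARSE — given the trail inequality (constant `L`) and the crux's `ℓ³` bound
`M`, at most `N(lam,θ,M,L,δ,K)` scales are late-active at level `δ`, horizon `K` (no ODE, no coefficients). -/
def LateSparsityStmt : Prop :=
  ∀ lam : ℝ, 1 < lam → ∀ θ : ℝ, 0 < θ → ∀ (m : ℕ) (M L δ K : ℝ), 0 ≤ L → 0 < δ → 0 ≤ K →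
    ∃ N : ℕ, ∀ (T : ℝ) (X : Fin m → ℤ → ℝ → ℝ), 0 < T →
      CritL3 lam T M X → TrailIneqOn lam θ L T X →
      ∀ S : Finset ℕ, (∀ j ∈ S, LateActive lam T δ K X j) → S.card ≤ N

/-- S-V statement (= the lead's registered `stub_valveBudget`). -/
def ValveBudgetStmt : Prop :=
  ∀ lam : ℝ, 1 < lam → ∀ (m : ℕ) (coeff : Fin m → Fin m → Fin m → Option (Fin 3) → ℝ),
    IsCyclic coeff → ∀ A : ℝ, ∃ δ₀ : ℝ, 0 < δ₀ ∧ ∃ C : ℝ, ValveBudgetAt lam coeff A δ₀ C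

/-- S-Q1 statement (= the lead's registered `stub_blockStaysQuiet`). -/
def BlockStaysQuietStmt : Prop :=
  ∀ lam : ℝ, 1 < lam → ∀ (m : ℕ) (coeff : Fin m → Fin m → Fin m → Option (Fin 3) → ℝ) (A : ℝ),
    ∃ δ₁ : ℝ, 0 < δ₁ ∧ BlockStaysQuietAt lam coeff A δ₁

/-- S-Q2 statement (= the lead's registered `stub_quietImpliesRegular`). -/
def QuietImpliesRegularStmt : Prop :=
  ∀ lam : ℝ, 1 < lam → ∀ (m : ℕ) (coeff : Fin m → Fin m → Fin m → Option (Fin 3) → ℝ) (A : ℝ),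
    ∃ ε₀ : ℝ, 0 < ε₀ ∧ QuietImpliesRegularAt lam coeff A ε₀

/-! ## The five registered stubs (fully unfolded statements; bodies `sorry`) -/

/-- **S-T (stub, M): TRAIL GRÖNWALL — the clock-discounted trail mass cannot be emptied faster than the top scale's
own clock** (companion card `clock-discounted-trail-mass`, First lemma `TraceInequality`; Disproof F1 in weighted,
critical-unit, cubic form — the item on the disprover's "still to build" list). For every `lam > 1`, `θ > 0`, circuit
and amplitude bound `A` there is `L = L(lam,θ,m,coeff,A) ≥ 0` such that for every solution of the circuit ODE on
`(0,T)` with no modes below `0` and `sup a ≤ A`: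
`e^{−L lam^{4j/5}(t−s)} H_j(s) ≤ H_j(t)` for all `j : ℕ`, `0 < s ≤ t < T`, `H_j(t) = Σ_{k≤j}Σ_i lam^{θ(k−j)} a_{i,k}(t)³`.
WHY TRUE (ideator 3; re-derived by the planner and by triage r1-1/2/3, toy ratios `sup −Ḣ_j/(lam^{4j/5}H_j)` = 11.4 /
3.1–7.7 / 6.8 ≪ crude `L`): per mode, in clock units, `ȧ_{i,k} = lam^{4k/5}(−a_{i,k} + Q_{i,k})` with
`|Q_{i,k}| ≤ K Σ_{i₁,i₂}(|a_{i₁,k}||a_{i₂,k}| + 2lam^{−1/5}|a_{·,k+1}||a_{·,k}| + lam^{−3/5}|a_{·,k−1}||a_{·,k−1}|)`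
(`K = max|coeff|`, `Negative.Structure.exists_coeff_bound`); EVERY monomial has a factor at scale `k` or `k−1`
(one-sided coupling), the other factor is bounded by `A⁺ = max A 0` (for `k = j` the factor `a_{j+1} ≤ A` sits OUTSIDE
the block but enters only as a coefficient); `d|x|³/dt = 3x|x|ẋ` is `C¹`; Young `a²b ≤ ⅔|a|³ + ⅓|b|³` over the mode
pairs gives, with `c_k := Σ_i|a_{i,k}|³`, `ċ_k ≥ −3lam^{4k/5}[α c_k + β c_{k−1}]`,
`α = 1 + K m² A⁺(1 + 2lam^{−1/5} + ⅔lam^{−3/5})`, `β = ⅓K m² A⁺ lam^{−3/5}`; multiply by `lam^{θ(k−j)}`, use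
`lam^{4k/5} ≤ lam^{4j/5}` on `k ≤ j`, re-index the `c_{k−1}` sum (price `lam^θ`; `c_{−1} = 0` by the cutoff):
`Ḣ_j ≥ −L lam^{4j/5} H_j`, `L := 3(α + β lam^θ)`; then `(e^{L lam^{4j/5} t}H_j)' ≥ 0` on `(0,T)`. Symmetry, cancellation
and the a-priori bound are NOT used. Degenerate instances: `m = 0` (`H ≡ 0`: `0 ≤ 0`), `A < 0` with `m ≥ 1, T > 0`
(hypothesis unsatisfiable: vacuous; with `T ≤ 0` the conclusion is vacuous).
LEANS ON: `Negative.LoadBearing.circuitRHS`; `Negative.Structure.circuitRHS_abs_le` / `block_backward_gronwall`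
(the `ℓ^∞`, unweighted form of the same one-sided Grönwall — proof template), `exists_coeff_bound`; Mathlib
`HasDerivAt.sum`, `hasDerivAt_abs`/`contDiff_norm_rpow`-type smoothness of `|x|³` (or `|x|³ = x²·|x|`),
`young_inequality_of_nonneg` / `Real.inner_le_nnorm_mul_nnorm`-free elementary `nlinarith`, `monotoneOn_of_deriv_nonneg`,
`Real.add_pow_le_pow_mul_pow_of_add_eq_one`. SOURCES: crux idea card clock-discounted-trail-mass (`TraceInequality`,
SketchIdeator3.lean rc 0); Cheskidov2008 arXiv:math/0601074 Thm 4.2 (linear-in-`u_n` one-sided structure, scalar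
ancestor); Tao2016AveragedNS arXiv:1402.0290 Lemma 4.1(v), (4.3) (offset set `S`, normalisation `X_{n<0} = 0`). -/
theorem stub_trailGronwall :
    ∀ lam : ℝ, 1 < lam → ∀ θ : ℝ, 0 < θ →
    ∀ (m : ℕ) (coeff : Fin m → Fin m → Fin m → Option (Fin 3) → ℝ) (A : ℝ),
      ∃ L : ℝ, 0 ≤ L ∧ ∀ (T : ℝ) (X : Fin m → ℤ → ℝ → ℝ),
        (∀ (i : Fin m) (n : ℤ), ∀ t ∈ Set.Ioo 0 T, HasDerivAt (X i n) (circuitRHS lam coeff X i n t) t) →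
        (∀ (i : Fin m) (n : ℤ) (t : ℝ), n < 0 → X i n t = 0) →
        (∀ t ∈ Set.Ico 0 T, ∀ (i : Fin m) (n : ℤ), lam ^ ((1 / 5 : ℝ) * n) * |X i n t| ≤ A) →
        ∀ (j : ℕ) (s t : ℝ), 0 < s → s ≤ t → t < T →
          Real.exp (-(L * lam ^ ((4 / 5 : ℝ) * j) * (t - s))) *
              (∑ k ∈ Finset.range (j + 1), ∑ i : Fin m,
                lam ^ (θ * ((k : ℝ) - j)) * (lam ^ ((1 / 5 : ℝ) * k) * |X i (k : ℤ) s|) ^ 3)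
            ≤ ∑ k ∈ Finset.range (j + 1), ∑ i : Fin m,
                lam ^ (θ * ((k : ℝ) - j)) * (lam ^ ((1 / 5 : ℝ) * k) * |X i (k : ℤ) t|) ^ 3 := by
  sorry

/-- **S-L (stub, M−): LATE ACTIVITY IS SPARSE** (companion card, `LateActivitySparse`; the ONLY use of `ℓ³`).
Pure real analysis — no ODE, no structure constants: for `lam > 1`, `θ > 0`, `0 ≤ L`, `0 < δ`, `0 ≤ K` and any `M`
there is `N : ℕ` (`N = ⌈max M 0 · e^{LK}/((1 − lam^{−θ})δ³)⌉` works) such that for every `T > 0` and every family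
`X` obeying the crux's finite-sum `ℓ³` bound `M` on `[0,T)` and the trail inequality with constant `L`, every finite
set `S` of LATE-ACTIVE scales (`j ∈ S` ⇒ some mode of scale `j` has `a_{i,j}(s) ≥ δ` at some `s ∈ (0,T)` with
`T − s ≤ K lam^{−4j/5}`) has `card S ≤ N`.
WHY TRUE (ideator 3; triage r1-1/2/3 re-derived): if `S ≠ ∅` let `t* := max_{j∈S} s_j ∈ (0,T)` (witness times).
For `j ∈ S`: `lam^{4j/5}(t* − s_j) ≤ lam^{4j/5}(T − s_j) ≤ K`, so the trail inequality from `s_j` to `t*` and `L ≥ 0`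
give `H_j(t*) ≥ e^{−LK} H_j(s_j) ≥ e^{−LK} δ³` (the `k = j` term of `H_j(s_j)` has weight `lam^0 = 1` and contains
`a_{i,j}(s_j)³ ≥ δ³`; all terms `≥ 0`). Sum over `j ∈ S ⊂ {0,…,J}`:
`card S · e^{−LK}δ³ ≤ Σ_{j≤J} H_j(t*) = Σ_{k≤J} c_k(t*) Σ_{j=k}^{J} lam^{−θ(j−k)} ≤ (1 − lam^{−θ})^{−1} Σ_{k≤J} c_k(t*)
≤ M/(1 − lam^{−θ})` (exchange the finite sums; geometric bound; the `ℓ³` hypothesis at `t*` with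
`s = {0,…,J} ⊂ ℤ`). Degenerate instances: `S = ∅`; `m = 0` (`LateActive` needs `∃ i : Fin 0`: only `S = ∅`
qualifies); `M < 0` (the `ℓ³` hypothesis with `s = ∅` reads `0 ≤ M`: vacuous).
LEANS ON: Mathlib `Finset.sum_comm` / `Finset.sum_sigma'`, `Finset.range` re-indexing (`Finset.sum_image`,
`Nat.cast` bookkeeping), `geom_sum_eq` / `tsum_geometric_of_lt_one`-free finite bound `Σ_{d<D} r^d ≤ (1−r)^{−1}`
(`geom_sum_lt`/`sum_geometric_two_le`-style), `Real.exp_le_exp`, `Real.rpow_neg`, `Real.rpow_natCast`, `Nat.le_ceil`,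
`Finset.exists_max_image`. SOURCES: crux idea card clock-discounted-trail-mass (`LateActivitySparse`, SketchIdeator3 rc 0);
facet `Literature.Barriers.NavierStokesRegularity.TruncatedDyadicTypeIBlowup` (evasions_known: `ℓ^q ≍ k^{1/q}` — the
count is sharp at `q = ∞`); BarbatoMorandinRomito2014Dyadic arXiv:1403.2852 Thm 5, §3.3.1 (energy bounding-sequence
bookkeeping near criticality). -/
theorem stub_lateSparsity :
    ∀ lam : ℝ, 1 < lam → ∀ θ : ℝ, 0 < θ → ∀ (m : ℕ) (M L δ K : ℝ), 0 ≤ L → 0 < δ → 0 ≤ K →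
    ∃ N : ℕ, ∀ (T : ℝ) (X : Fin m → ℤ → ℝ → ℝ), 0 < T →
      (∀ t ∈ Set.Ico 0 T, ∀ s : Finset ℤ,
          ∑ n ∈ s, ∑ i : Fin m, (lam ^ ((1 / 5 : ℝ) * n) * |X i n t|) ^ 3 ≤ M) →
      (∀ (j : ℕ) (s t : ℝ), 0 < s → s ≤ t → t < T →
          Real.exp (-(L * lam ^ ((4 / 5 : ℝ) * j) * (t - s))) *
              (∑ k ∈ Finset.range (j + 1), ∑ i : Fin m,
                lam ^ (θ * ((k : ℝ) - j)) * (lam ^ ((1 / 5 : ℝ) * k) * |X i (k : ℤ) s|) ^ 3)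
            ≤ ∑ k ∈ Finset.range (j + 1), ∑ i : Fin m,
                lam ^ (θ * ((k : ℝ) - j)) * (lam ^ ((1 / 5 : ℝ) * k) * |X i (k : ℤ) t|) ^ 3) →
      ∀ S : Finset ℕ,
        (∀ j ∈ S, ∃ i : Fin m, ∃ s ∈ Set.Ioo 0 T,
            T - s ≤ K * lam ^ (-((4 / 5 : ℝ) * j)) ∧ δ ≤ lam ^ ((1 / 5 : ℝ) * j) * |X i (j : ℤ) s|) →
        S.card ≤ N := by
  sorry

/-- **S-V (stub, L — HARDEST): the QUIET-VALVE BUDGET** (this card's First lemma `ValveBudget`, `ℓ^∞` form; SHARED: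
verbatim the lead's registered `stub_valveBudget`). For every `lam > 1`, every CYCLIC-CANCELLING circuit and every `A`
there are `δ₀ = δ₀(lam,m,coeff) > 0` and `C = C(lam,m,A)` such that for `0 < δ ≤ δ₀`, every solution on `(0,T)` (ODE,
cutoff, a-priori `H¹⁰` bound, `sup a ≤ A`), every valve `n ≥ 0` and window `[t₁,t₂] ⊂ (0,T)` on which the valve is
`δ`-QUIET while at EVERY instant some mode STRICTLY ABOVE `n` is `δ`-ACTIVE: `δ² · lam^{4(n+1)/5} · (t₂ − t₁) ≤ C`.
WHY TRUE (card; planner, lead and three triagers re-derived; 0 violations in all toys, worst `dℰ/dτ = −2.89δ²`):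
FINITE block energies suffice (lead's preference; no `tsum` interface): `ℰ_N(t) := lam^{2(n+1)/5} Σ_{n<j≤N} e_j`,
`e_j = Σ_i X_{i,j}²`. Cyclic cancellation conserves energy triad by triad, so (kernel-checked per-scale identity
`SketchIdeator2G2.efficiencyShadow`, from `trilinear_cancel`) `ė_j = −2lam^{4j/5}e_j + π_{j−1} − π_j`,
`π_j = 2lam^j Σ coeff(i₁,i₂,i₃,some 2) X_{i₁,j}X_{i₂,j}X_{i₃,j+1}`, `|π_j| ≤ 2K m^{3/2} lam^j e_j √e_{j+1}`
(`SketchIdeator2G2.triadFluxBound`); telescoping, `dℰ_N/dt = lam^{2(n+1)/5}[−2Σ_{n<j≤N} lam^{4j/5}e_j + π_n − π_N]`, and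
by the a-priori bound on `[0,t₂]` (`|X_j| ≤ C' lam^{−4j}`) `π_N → 0` uniformly on `[t₁,t₂]` while the `δ`-active modes
live at scales `≤ J(C',δ)`. In `(n+1)`-clock time `τ`: `dℰ_N/dτ ≤ −2Σ_{n<j≤N} lam^{(2/5)(j−n−1)}|a_j|² + 2rδ²|a_{n+1}| + o(1)`,
`r = K m^{5/2} lam^{−3/5}` (valve `δ`-quiet, per-mode). KEY STEP (answers Disproof §6): scale `n+1`'s OWN dissipation
absorbs the leak — `−2x² + 2rδ²x ≤ r²δ⁴/2`; if the active mode is at `n+1`: `2|a_{n+1}|(rδ² − |a_{n+1}|) ≤ −δ²`; if at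
`≥ n+2`: `≤ −2lam^{2/5}δ² + r²δ⁴/2 ≤ −δ²`; both once `rδ ≤ ½`, i.e. `δ₀ := lam^{3/5}/(2(K+1)(m+1)^{5/2})`. Integrate and
let `N → ∞`: `δ² lam^{4(n+1)/5}(t₂ − t₁) ≤ sup ℰ ≤ (m+1)(max A 0)²/(1 − lam^{−2/5}) =: C`. Symmetry (4.2) unused.
Degenerate instances: `m = 0` (no active mode: vacuous), `t₁ = t₂` (`0 ≤ C`), `A < 0` (vacuous).
LEANS ON: `Negative.LoadBearing.circuitRHS`, `IsCyclic`; `Negative.Structure.trilinear_cancel`, `exists_coeff_bound`;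
`Cruxes/CircuitTrace/SketchIdeator2G2.lean` `efficiencyShadow`, `triadFluxBound`, `hasDerivAt_scaleEnergy` (kernel-checked,
copy into the proof file); Mathlib `HasDerivAt.sum`, `image_le_of_deriv_right_lt_deriv_boundary` /
`antitoneOn_of_deriv_nonpos`, `Finset.sum_range_succ_sub_sum`-style telescoping, `tendsto` in `N` or an `ε`-room
argument. SOURCES: crux idea cards quiet-valve-budget (`TriadFlux`, `ValveBudget`), cold-gap-starvation
(`flux_through_cut`); Tao2016AveragedNS arXiv:1402.0290 §4 (4.2)–(4.4), Lemma 4.1, §5.1–5.2 (pump gate `U² + V²`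
non-increasing = the two-mode budget; tree: `Literature.Barriers.NavierStokesRegularity.TruncatedDyadic.StepData.sq_add_sq_le_one`);
BarbatoMorandinRomito2011 arXiv:1007.3401 Lemma 2.1, Prop 3.3; CheskidovDaiFriedlander2023 arXiv:2209.10203 §3.1.4. -/
theorem stub_valveBudget :
    ∀ lam : ℝ, 1 < lam → ∀ (m : ℕ) (coeff : Fin m → Fin m → Fin m → Option (Fin 3) → ℝ), IsCyclic coeff →
    ∀ A : ℝ, ∃ δ₀ : ℝ, 0 < δ₀ ∧ ∃ C : ℝ, ∀ δ : ℝ, 0 < δ → δ ≤ δ₀ →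
      ∀ (T : ℝ) (X : Fin m → ℤ → ℝ → ℝ), 0 < T →
      (∀ (i : Fin m) (n : ℤ), ∀ t ∈ Set.Ioo 0 T, HasDerivAt (X i n) (circuitRHS lam coeff X i n t) t) →
      (∀ (i : Fin m) (n : ℤ) (t : ℝ), n < 0 → X i n t = 0) →
      (∀ T' ∈ Set.Ioo 0 T, ∃ C : ℝ, ∀ (i : Fin m) (n : ℤ), ∀ t ∈ Set.Icc 0 T',
          lam ^ ((4 : ℝ) * n) * |X i n t| ≤ C) →
      (∀ t ∈ Set.Ico 0 T, ∀ (i : Fin m) (n : ℤ), lam ^ ((1 / 5 : ℝ) * n) * |X i n t| ≤ A) →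
      ∀ n : ℤ, 0 ≤ n → ∀ t₁ t₂ : ℝ, 0 < t₁ → t₁ ≤ t₂ → t₂ < T →
        (∀ i : Fin m, ∀ t ∈ Set.Icc t₁ t₂, lam ^ ((1 / 5 : ℝ) * n) * |X i n t| ≤ δ) →
        (∀ t ∈ Set.Icc t₁ t₂, ∃ (i : Fin m) (j : ℤ), n < j ∧ δ ≤ lam ^ ((1 / 5 : ℝ) * j) * |X i j t|) →
        δ ^ 2 * lam ^ ((4 / 5 : ℝ) * (n + 1)) * (t₂ - t₁) ≤ C := by
  sorry

/-- **S-Q1 (stub, M−): A QUIET BLOCK ABOVE A QUIET VALVE STAYS QUIET** (this card's `QuietBlockRegular`, maximum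
principle MP1; SHARED: verbatim the lead's registered `stub_blockStaysQuiet`). For every `lam > 1`, circuit and `A`
there is `δ₁ = δ₁(lam,m,coeff) > 0` such that for `0 < δ ≤ δ₁`: if the valve `n ≥ 0` is `δ`-quiet on `[t₁,T)`
(`t₁ ∈ (0,T)`) and every mode above `n` is `δ`-quiet AT `t₁`, then every mode above `n` is `2δ`-quiet on `[t₁,T)`.
WHY TRUE (Disproof F3; triage r1-1/2/3): fix `T' < T`; by the a-priori bound `a_{i,j} ≤ C_{T'} lam^{−19j/5} < 2δ` for
`j > J` on `[0,T']`, so only the finitely many continuous `a_{i,j}`, `n < j ≤ J`, can reach `2δ`; at a FIRST time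
`t* > t₁` where one of them touches `2δ` (all scales `≥ n` are `≤ 2δ` up to `t*`, the valve even `≤ δ`), in clock units
`ȧ_{i,j}(t*) ≤ lam^{4j/5}(−2δ + K m²(1 + 2lam^{−1/5} + lam^{−3/5})(2δ)²) < 0` provided `8(K+1)(m+1)²δ ≤ 1` — but a
function below `2δ` before `t*` and equal to `2δ` at `t*` has derivative `≥ 0` there (`X_{i,j}(t*) ≠ 0`, so `|X|` is
differentiable). Every monomial driving a scale `j > n` has its factors at scales `≥ j − 1 ≥ n` (the valve enters only
through `a_n² lam^{−3/5}` at `j = n+1`), so scales `< n` and the bound `A` are not needed; `δ₁ := 1/(16(K+1)(m+1)²)`.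
Degenerate instances: `m = 0` (conclusion vacuous), `A < 0` (vacuous).
LEANS ON: `circuitRHS`; `Negative.Structure.circuitRHS_abs_le` (estimate template); Mathlib first-hitting-time
bookkeeping (`IsClosed.csInf_mem` / `exists_isMinOn` on `Icc`, `ContinuousOn.max` over a `Finset`), `hasDerivAt_abs`,
sign of the derivative at a one-sided max (`IsLocalMaxOn`-free: `HasDerivAt` + `Filter.Eventually` comparison, or
`image_le_of_deriv_right_lt_deriv_boundary`). SOURCES: crux idea card quiet-valve-budget (MP1); Disproof.lean docstring
(F3) `δ₀ = 1/(16m²K lam⁴)`; BarbatoMorandinRomito2011 arXiv:1007.3401 Prop 3.3; Cheskidov2008 arXiv:math/0601074 Thm 4.3. -/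
theorem stub_blockStaysQuiet :
    ∀ lam : ℝ, 1 < lam → ∀ (m : ℕ) (coeff : Fin m → Fin m → Fin m → Option (Fin 3) → ℝ) (A : ℝ),
    ∃ δ₁ : ℝ, 0 < δ₁ ∧ ∀ δ : ℝ, 0 < δ → δ ≤ δ₁ →
      ∀ (T : ℝ) (X : Fin m → ℤ → ℝ → ℝ), 0 < T →
      (∀ (i : Fin m) (n : ℤ), ∀ t ∈ Set.Ioo 0 T, HasDerivAt (X i n) (circuitRHS lam coeff X i n t) t) →
      (∀ (i : Fin m) (n : ℤ) (t : ℝ), n < 0 → X i n t = 0) →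
      (∀ T' ∈ Set.Ioo 0 T, ∃ C : ℝ, ∀ (i : Fin m) (n : ℤ), ∀ t ∈ Set.Icc 0 T',
          lam ^ ((4 : ℝ) * n) * |X i n t| ≤ C) →
      (∀ t ∈ Set.Ico 0 T, ∀ (i : Fin m) (n : ℤ), lam ^ ((1 / 5 : ℝ) * n) * |X i n t| ≤ A) →
      ∀ n : ℤ, 0 ≤ n → ∀ t₁ ∈ Set.Ioo 0 T,
        (∀ i : Fin m, ∀ t ∈ Set.Ico t₁ T, lam ^ ((1 / 5 : ℝ) * n) * |X i n t| ≤ δ) →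
        (∀ (i : Fin m) (j : ℤ), n < j → lam ^ ((1 / 5 : ℝ) * j) * |X i j t₁| ≤ δ) →
        ∀ (i : Fin m) (j : ℤ), n < j → ∀ t ∈ Set.Ico t₁ T, lam ^ ((1 / 5 : ℝ) * j) * |X i j t| ≤ 2 * δ := by
  sorry

/-- **S-Q2 (stub, M): A QUIET HALF-LINE IS `H¹⁰`-BOUNDED** (this card's `QuietBlockRegular`, weighted maximum
principle MP2 + one Duhamel step; SHARED: verbatim the lead's registered `stub_quietImpliesRegular`). For every
`lam > 1`, circuit and `A` there is `ε₀ = ε₀(lam,m,coeff) > 0` such that: if every scale `j ≥ n` (`n ≥ 0`) is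
`ε₀`-quiet on a final window `[t₁,T)`, `t₁ ∈ (0,T)`, then `sup_{[0,T)} lam^{4j}|X_{i,j}| < ∞` (the crux's conclusion).
WHY TRUE (Disproof F3; triage r1-1/2/3; lead): with `w_{i,j} := lam^{σj}|X_{i,j}|`, `σ := 3 ∈ [21/10, 4)`, in clock
units `ẇ_{i,j} ≤ lam^{4j/5}(−w_{i,j} + K m²(1 + 2lam^{−1/5} + lam^{σ−4/5}) ε₀ · W + [j = n]·B)` for `j ≥ n`, where `W` is
the sup of `w` over scales `≥ n` (a MAX on `[t₁,T']`, `T' < T`: by the a-priori bound `w_j ≤ C_{T'}lam^{(σ−4)j} → 0`)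
and `B = K m² lam^{σ−4/5} · lam^{(σ−1/5)(n−1)} (max A 0)²` is the fixed forcing of scale `n` by scale `n−1` (`≤ A`,
outside the half-line; absent if `n = 0`); for `4(K+1)(m+1)²(3 + lam^{σ−4/5})ε₀ ≤ 1` the max principle gives
`W(t) ≤ max(W(t₁), 2B)` on `[t₁,T)`; one Duhamel step `X_j(t) = e^{−lam^{4j/5}(t−t₁)}X_j(t₁) + ∫ e^{−lam^{4j/5}(t−s)}N_j`
with both factors of `N_j` at weight `σ` (`lam^{4j}·lam^{−4j/5}·lam^{j}·lam^{−2σj} = lam^{(21/5−2σ)j} ≤ 1`) restores the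
weight `4` on `[t₁,T)`; scales `0 ≤ j < n`: `lam^{4j}|X_{i,j}| ≤ lam^{19n/5}A`; scales `< 0` vanish; `[0,t₁]` is covered
by the a-priori bound at `T' = t₁`. `ε₀ := 1/(4(K+1)(m+1)²(3 + lam^{11/5}))`. Degenerate instances: `m = 0`, `A < 0`.
LEANS ON: `circuitRHS`; `Negative.Structure.circuitRHS_abs_le`, `block_backward_gronwall` (sup-norm ODE comparison
template); Mathlib `norm_le_gronwallBound_of_norm_deriv_right_le`, `image_le_of_deriv_right_lt_deriv_boundary`,
variation of constants via `intervalIntegral` (`integral_hasDerivAt_right`), `Real.add_pow_le_pow_mul_pow_of_add_eq_one`.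
SOURCES: crux idea card quiet-valve-budget (MP2); Disproof.lean (F3); BarbatoMorandinRomito2011 arXiv:1007.3401
Prop 3.3 (small critical tail ⇒ smooth); Cheskidov2008 arXiv:math/0601074 Thm 4.3; Tao2016AveragedNS arXiv:1402.0290
Lemma 4.1 (iv)–(v). -/
theorem stub_quietImpliesRegular :
    ∀ lam : ℝ, 1 < lam → ∀ (m : ℕ) (coeff : Fin m → Fin m → Fin m → Option (Fin 3) → ℝ) (A : ℝ),
    ∃ ε₀ : ℝ, 0 < ε₀ ∧ ∀ (T : ℝ) (X : Fin m → ℤ → ℝ → ℝ), 0 < T →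
      (∀ (i : Fin m) (n : ℤ), ∀ t ∈ Set.Ioo 0 T, HasDerivAt (X i n) (circuitRHS lam coeff X i n t) t) →
      (∀ (i : Fin m) (n : ℤ) (t : ℝ), n < 0 → X i n t = 0) →
      (∀ T' ∈ Set.Ioo 0 T, ∃ C : ℝ, ∀ (i : Fin m) (n : ℤ), ∀ t ∈ Set.Icc 0 T',
          lam ^ ((4 : ℝ) * n) * |X i n t| ≤ C) →
      (∀ t ∈ Set.Ico 0 T, ∀ (i : Fin m) (n : ℤ), lam ^ ((1 / 5 : ℝ) * n) * |X i n t| ≤ A) →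
      ∀ n : ℤ, 0 ≤ n → ∀ t₁ ∈ Set.Ioo 0 T,
        (∀ (i : Fin m) (j : ℤ), n ≤ j → ∀ t ∈ Set.Ico t₁ T, lam ^ ((1 / 5 : ℝ) * j) * |X i j t| ≤ ε₀) →
        ∃ C : ℝ, ∀ (i : Fin m) (j : ℤ), ∀ t ∈ Set.Ico 0 T, lam ^ ((4 : ℝ) * j) * |X i j t| ≤ C := by
  sorry

/-! ## Proved glue -/

/-- From the crux's finite-sum `ℓ³` hypothesis every critical amplitude is `≤ max M 1` (a single cube `≤ M`). -/
theorem critSup_of_l3 {lam : ℝ} (hlam : 1 < lam) {m : ℕ} {T M : ℝ} {X : Fin m → ℤ → ℝ → ℝ}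
    (hM : CritL3 lam T M X) : CritSup lam T (max M 1) X := by
  have hlam0 : 0 < lam := by linarith
  intro t ht i n
  have h1 := hM t ht {n}
  rw [Finset.sum_singleton] at h1
  have hpow : 0 ≤ lam ^ ((1 / 5 : ℝ) * n) := (Real.rpow_pos_of_pos hlam0 _).le
  have h0 : 0 ≤ lam ^ ((1 / 5 : ℝ) * n) * |X i n t| := mul_nonneg hpow (abs_nonneg _)
  have h2 : (lam ^ ((1 / 5 : ℝ) * n) * |X i n t|) ^ 3 ≤ M :=
    le_trans (Finset.single_le_sum (f := fun j => (lam ^ ((1 / 5 : ℝ) * n) * |X j n t|) ^ 3)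
      (fun j _ => pow_nonneg (mul_nonneg hpow (abs_nonneg _)) 3) (Finset.mem_univ i)) h1
  by_contra hlt
  have hlt' := not_le.mp hlt
  set x := lam ^ ((1 / 5 : ℝ) * n) * |X i n t| with hx
  have h3 : 1 ≤ x := (lt_of_le_of_lt (le_max_right _ _) hlt').le
  have h4 : M < x := lt_of_le_of_lt (le_max_left _ _) hlt'
  have h5 : x ≤ x ^ 3 := by
    have hx1 : 1 ≤ x * x := by nlinarith
    calc x = x * 1 := (mul_one x).symm
      _ ≤ x * (x * x) := mul_le_mul_of_nonneg_left hx1 h0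
      _ = x ^ 3 := by ring
  linarith

/-- Own-clock windows shrink: for `lam > 1`, `K ≥ 0`, `T > 0` some scale `n₀ : ℕ` has `K·lam^{−4n₀/5} < T`, and the
window length is antitone in the scale. -/
theorem exists_window_lt {lam : ℝ} (hlam : 1 < lam) {K T : ℝ} (hK : 0 ≤ K) (hT : 0 < T) :
    ∃ n₀ : ℕ, ∀ n : ℕ, n₀ ≤ n → K * lam ^ (-((4 / 5 : ℝ) * n)) < T := by
  have hlam0 : 0 < lam := by linarith
  set r : ℝ := lam ^ (-(4 / 5 : ℝ)) with hr
  have hr0 : 0 < r := Real.rpow_pos_of_pos hlam0 _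
  have hr1 : r < 1 := Real.rpow_lt_one_of_one_lt_of_neg hlam (by norm_num)
  have hpow : ∀ n : ℕ, lam ^ (-((4 / 5 : ℝ) * n)) = r ^ n := by
    intro n
    rw [hr, ← Real.rpow_natCast, ← Real.rpow_mul hlam0.le]
    congr 1
    ring
  obtain ⟨n₀, hn₀⟩ := exists_pow_lt_of_lt_one (show 0 < T / (K + 1) by positivity) hr1
  refine ⟨n₀, fun n hn => ?_⟩
  have hmono : r ^ n ≤ r ^ n₀ := pow_le_pow_of_le_one hr0.le hr1.le hn
  have hKT : K * (T / (K + 1)) < T := by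
    have hK1 : (0 : ℝ) < K + 1 := by linarith
    have hlt : K / (K + 1) < 1 := by rw [div_lt_one hK1]; linarith
    calc K * (T / (K + 1)) = K / (K + 1) * T := by ring
      _ < 1 * T := mul_lt_mul_of_pos_right hlt hT
      _ = T := one_mul T
  calc K * lam ^ (-((4 / 5 : ℝ) * n)) = K * r ^ n := by rw [hpow]
    _ ≤ K * r ^ n₀ := mul_le_mul_of_nonneg_left hmono hK
    _ ≤ K * (T / (K + 1)) := mul_le_mul_of_nonneg_left hn₀.le hK
    _ < T := hKT

/-- **Transfer `C⁺ ⇒ crux` (the card's `Transfer:`), real proof: ONE EARLY-RETIRED SCALE IS ENOUGH.** Given the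
valve budget (S-V's conclusion at this circuit: `δ₀, C`), quiet-persistence (S-Q1: `δ₁`) and quiet ⇒ regular
(S-Q2: `ε₀`), a level `0 < δ ≤ δ₀, δ₁, ε₀/2`, and a solution with `sup a ≤ A`: if some scale `n ≥ 0` has NO
`δ`-exceedance during a final window of length `w ∈ (0,T)` that is LONG in `(n+1)`-clock units
(`2C < δ² lam^{4(n+1)/5} w`), the solution is regular. Proof = the exhaustive dichotomy on `[T−w, T)`: either every
mode above `n` is `δ`-quiet at some instant `t₁` of the window — S-Q1 keeps the block `2δ`-quiet on `[t₁,T)`, the valve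
is `δ`-quiet there, and S-Q2 (threshold `ε₀ ≥ 2δ`) concludes — or at every instant of the window some mode above `n`
is `δ`-active, and S-V on `[T−w, T−w/2]` gives `δ² lam^{4(n+1)/5} · w/2 ≤ C`, contradicting the length hypothesis. -/
theorem regular_of_earlyRetiredScale {lam : ℝ} {m : ℕ}
    {coeff : Fin m → Fin m → Fin m → Option (Fin 3) → ℝ} {A δ₀ C δ₁ ε₀ : ℝ}
    (hVB : ValveBudgetAt lam coeff A δ₀ C) (hQB : BlockStaysQuietAt lam coeff A δ₁)
    (hQR : QuietImpliesRegularAt lam coeff A ε₀)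
    {T : ℝ} {X : Fin m → ℤ → ℝ → ℝ} (hT : 0 < T) (hode : OdeOn lam coeff T X) (hcut : Cutoff X)
    (hapr : Apriori lam T X) (hA : CritSup lam T A X)
    {δ : ℝ} (hδ : 0 < δ) (hδ₀ : δ ≤ δ₀) (hδ₁ : δ ≤ δ₁) (hε : 2 * δ ≤ ε₀)
    {n : ℤ} (hn : 0 ≤ n) {w : ℝ} (hw0 : 0 < w) (hwT : w < T)
    (hlong : 2 * C < δ ^ 2 * lam ^ ((4 / 5 : ℝ) * (n + 1)) * w)
    (hquiet : ∀ i : Fin m, ∀ t ∈ Set.Ioo 0 T, T - t ≤ w → lam ^ ((1 / 5 : ℝ) * n) * |X i n t| ≤ δ) :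
    Regular lam T X := by
  set t₀ : ℝ := T - w with ht₀def
  have ht₀0 : 0 < t₀ := by rw [ht₀def]; linarith
  have ht₀T : t₀ < T := by rw [ht₀def]; linarith
  -- the valve `n` is δ-quiet on the final window [t₀, T)
  have hvalve : ∀ i : Fin m, ∀ t ∈ Set.Ico t₀ T, lam ^ ((1 / 5 : ℝ) * n) * |X i n t| ≤ δ := by
    intro i t ht
    refine hquiet i t ⟨lt_of_lt_of_le ht₀0 ht.1, ht.2⟩ ?_
    have := ht.1; rw [ht₀def] at this; linarith
  by_cases hcase : ∃ t₁ ∈ Set.Ico t₀ T, ∀ (i : Fin m) (j : ℤ), n < j → lam ^ ((1 / 5 : ℝ) * j) * |X i j t₁| ≤ δ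
  · -- Case A: the block above `n` is δ-quiet at some instant `t₁` of the window ⇒ regular (S-Q1 + S-Q2)
    obtain ⟨t₁, ht₁, hblock⟩ := hcase
    have ht₁' : t₁ ∈ Set.Ioo 0 T := ⟨lt_of_lt_of_le ht₀0 ht₁.1, ht₁.2⟩
    have hvalve₁ : ∀ i : Fin m, ∀ t ∈ Set.Ico t₁ T, lam ^ ((1 / 5 : ℝ) * n) * |X i n t| ≤ δ :=
      fun i t ht => hvalve i t ⟨le_trans ht₁.1 ht.1, ht.2⟩
    have h2δ := hQB δ hδ hδ₁ T X hT hode hcut hapr hA n hn t₁ ht₁' hvalve₁ hblock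
    refine hQR T X hT hode hcut hapr hA n hn t₁ ht₁' ?_
    intro i j hj t ht
    rcases lt_or_eq_of_le hj with hlt | heq
    · exact le_trans (h2δ i j hlt t ht) hε
    · subst heq
      have := hvalve₁ i t ht
      linarith
  · -- Case B: at every instant of the window some mode above `n` is δ-active ⇒ budget (S-V) on [t₀, T - w/2]
    push Not at hcase
    exfalso
    set t₂ : ℝ := T - w / 2 with ht₂def
    have ht₀₂ : t₀ ≤ t₂ := by rw [ht₀def, ht₂def]; linarith
    have ht₂T : t₂ < T := by rw [ht₂def]; linarith
    have hbud := hVB δ hδ hδ₀ T X hT hode hcut hapr hA n hn t₀ t₂ ht₀0 ht₀₂ ht₂T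
      (fun i t ht => hvalve i t ⟨ht.1, lt_of_le_of_lt ht.2 ht₂T⟩)
      (fun t ht => by
        obtain ⟨i, j, hj, hlt⟩ := hcase t ⟨ht.1, lt_of_le_of_lt ht.2 ht₂T⟩
        exact ⟨i, j, hj, hlt.le⟩)
    have hlen : t₂ - t₀ = w / 2 := by rw [ht₂def, ht₀def]; ring
    rw [hlen] at hbud
    have : δ ^ 2 * lam ^ ((4 / 5 : ℝ) * (n + 1)) * (w / 2)
        = (δ ^ 2 * lam ^ ((4 / 5 : ℝ) * (n + 1)) * w) / 2 := by ring
    rw [this] at hbud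
    linarith

/-- **Pigeonhole, real proof: an EARLY-RETIRED SCALE exists.** If at most `N` scales are late-active (level `δ`,
horizon `K`) among any finite set, then above any `n₀` some scale `n ≤ n₀ + N` is NOT late-active: no mode of scale `n`
has a `δ`-exceedance within `K` own-clock units of `T`. -/
theorem exists_earlyRetiredScale {lam : ℝ} {m : ℕ} {T δ K : ℝ} {X : Fin m → ℤ → ℝ → ℝ} {N : ℕ}
    (hN : ∀ S : Finset ℕ, (∀ j ∈ S, LateActive lam T δ K X j) → S.card ≤ N) (n₀ : ℕ) :
    ∃ n : ℕ, n₀ ≤ n ∧ ¬ LateActive lam T δ K X n := by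
  by_contra hall
  push Not at hall
  have hS := hN (Finset.Ico n₀ (n₀ + N + 1)) (fun j hj => hall j (Finset.mem_Ico.mp hj).1)
  rw [Nat.card_Ico] at hS
  omega

/-- **Composition (the real proof, sorry-free): `S-T → S-L → S-V → S-Q1 → S-Q2 → CircuitTrace'`.** Fix the crux
data with `ℓ³` bound `M`; `A := max M 1` bounds every critical amplitude (`critSup_of_l3`); S-V, S-Q1, S-Q2 give
`δ₀, C, δ₁, ε₀` for this circuit and bound; `δ := min δ₀ (min δ₁ (ε₀/2))`, `K := 2·max C 0/(δ² lam^{4/5}) + 1`; S-T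
(`θ = 1`) gives `L` and the trail inequality for this solution, S-L the bound `N` on late-active scales; choose `n₀`
with `K lam^{−4n₀/5} < T` (`exists_window_lt`) and an early-retired `n ∈ [n₀, n₀+N]` (`exists_earlyRetiredScale`); its
final window `w = K lam^{−4n/5}` satisfies `δ² lam^{4(n+1)/5} w = δ² lam^{4/5} K = 2·max C 0 + δ² lam^{4/5} > 2C`, so
`regular_of_earlyRetiredScale` yields the crux's conclusion. -/
theorem circuitTrace_of_parts (hTG : TrailGronwallStmt) (hLS : LateSparsityStmt) (hV : ValveBudgetStmt)
    (hQ1 : BlockStaysQuietStmt) (hQ2 : QuietImpliesRegularStmt) : CircuitTrace' := by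
  intro lam hlam m coeff _hsym hcyc T hT X _hcont hderiv hcut hapr hM3
  obtain ⟨M, hM⟩ := hM3
  have hlam0 : 0 < lam := by linarith
  have hode : OdeOn lam coeff T X := hderiv
  have hcut' : Cutoff X := hcut
  have hapr' : Apriori lam T X := hapr
  have hL3 : CritL3 lam T M X := hM
  have hA : CritSup lam T (max M 1) X := critSup_of_l3 hlam hL3
  -- constants of the three valve-side stubs at this circuit and amplitude bound
  obtain ⟨δ₀, hδ₀, C, hVB⟩ := hV lam hlam m coeff hcyc (max M 1)
  obtain ⟨δ₁, hδ₁, hQB⟩ := hQ1 lam hlam m coeff (max M 1)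
  obtain ⟨ε₀, hε₀, hQR⟩ := hQ2 lam hlam m coeff (max M 1)
  set δ : ℝ := min δ₀ (min δ₁ (ε₀ / 2)) with hδdef
  have hδ : 0 < δ := lt_min hδ₀ (lt_min hδ₁ (by linarith))
  have hδle₀ : δ ≤ δ₀ := min_le_left _ _
  have hδle₁ : δ ≤ δ₁ := le_trans (min_le_right _ _) (min_le_left _ _)
  have hδε : 2 * δ ≤ ε₀ := by
    have : δ ≤ ε₀ / 2 := le_trans (min_le_right _ _) (min_le_right _ _)
    linarith
  -- the horizon K (long enough for the valve budget to bite) and the trail-side constants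
  have hP : 0 < δ ^ 2 * lam ^ (4 / 5 : ℝ) := mul_pos (pow_pos hδ 2) (Real.rpow_pos_of_pos hlam0 _)
  set K : ℝ := 2 * max C 0 / (δ ^ 2 * lam ^ (4 / 5 : ℝ)) + 1 with hKdef
  have hK0 : 0 ≤ K := by
    have : 0 ≤ 2 * max C 0 / (δ ^ 2 * lam ^ (4 / 5 : ℝ)) :=
      div_nonneg (mul_nonneg (by norm_num) (le_max_right _ _)) hP.le
    rw [hKdef]; linarith
  have hPne : δ ^ 2 * lam ^ (4 / 5 : ℝ) ≠ 0 := hP.ne'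
  have hKP : δ ^ 2 * lam ^ (4 / 5 : ℝ) * K = 2 * max C 0 + δ ^ 2 * lam ^ (4 / 5 : ℝ) := by
    rw [hKdef, mul_add, mul_one, ← mul_div_assoc, mul_div_cancel_left₀ _ hPne]
  obtain ⟨L, hL0, hTGL⟩ := hTG lam hlam 1 one_pos m coeff (max M 1)
  obtain ⟨N, hN⟩ := hLS lam hlam 1 one_pos m M L δ K hL0 hδ hK0
  have htrail : TrailIneqOn lam 1 L T X := hTGL T X hode hcut' hA
  have hsparse := hN T X hT hL3 htrail
  -- an early-retired scale n with a window inside (0,T)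
  obtain ⟨n₀, hn₀⟩ := exists_window_lt hlam hK0 hT
  obtain ⟨n, hn₀n, hret⟩ := exists_earlyRetiredScale hsparse n₀
  set w : ℝ := K * lam ^ (-((4 / 5 : ℝ) * n)) with hwdef
  have hwT : w < T := hn₀ n hn₀n
  have hpown : 0 < lam ^ (-((4 / 5 : ℝ) * n)) := Real.rpow_pos_of_pos hlam0 _
  have hK1 : 1 ≤ K := by
    have : 0 ≤ 2 * max C 0 / (δ ^ 2 * lam ^ (4 / 5 : ℝ)) :=
      div_nonneg (mul_nonneg (by norm_num) (le_max_right _ _)) hP.le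
    rw [hKdef]; linarith
  have hw0 : 0 < w := by rw [hwdef]; exact mul_pos (by linarith) hpown
  -- the early-retired scale is a δ-quiet valve on its final window
  have hquiet : ∀ i : Fin m, ∀ t ∈ Set.Ioo 0 T, T - t ≤ w →
      lam ^ ((1 / 5 : ℝ) * ((n : ℤ) : ℝ)) * |X i (n : ℤ) t| ≤ δ := by
    intro i t ht htw
    have hcast : ((n : ℤ) : ℝ) = (n : ℝ) := Int.cast_natCast n
    rw [hcast]
    by_contra hlt
    exact hret ⟨i, t, ht, htw, (not_le.mp hlt).le⟩
  -- window length in (n+1)-clock units: δ² lam^{4(n+1)/5} w = δ² lam^{4/5} K > 2C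
  have hlong : 2 * C < δ ^ 2 * lam ^ ((4 / 5 : ℝ) * (((n : ℤ) : ℝ) + 1)) * w := by
    have hcast : ((n : ℤ) : ℝ) = (n : ℝ) := Int.cast_natCast n
    have hexp : lam ^ ((4 / 5 : ℝ) * ((n : ℝ) + 1)) * lam ^ (-((4 / 5 : ℝ) * n)) = lam ^ (4 / 5 : ℝ) := by
      rw [← Real.rpow_add hlam0]
      congr 1
      ring
    have hval : δ ^ 2 * lam ^ ((4 / 5 : ℝ) * ((n : ℝ) + 1)) * w = 2 * max C 0 + δ ^ 2 * lam ^ (4 / 5 : ℝ) := by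
      rw [hwdef, ← hKP]
      calc δ ^ 2 * lam ^ ((4 / 5 : ℝ) * ((n : ℝ) + 1)) * (K * lam ^ (-((4 / 5 : ℝ) * n)))
          = δ ^ 2 * (lam ^ ((4 / 5 : ℝ) * ((n : ℝ) + 1)) * lam ^ (-((4 / 5 : ℝ) * n))) * K := by ring
        _ = δ ^ 2 * lam ^ (4 / 5 : ℝ) * K := by rw [hexp]
    rw [hcast, hval]
    have hC : C ≤ max C 0 := le_max_left _ _
    linarith
  exact regular_of_earlyRetiredScale hVB hQB hQR hT hode hcut' hapr' hA hδ hδle₀ hδle₁ hδε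
    (Int.natCast_nonneg n) hw0 hwT hlong hquiet

/-- **The skeleton concludes the crux BY NAME** (the `#h21_check_skeleton` theorem): the five registered stubs, fed to
the sorry-free `circuitTrace_of_parts` and transported along the landed `circuitTrace_iff` (`Iff.rfl`), give
`Summit.NavierStokesRegularity.NavierStokesRegularity.Theses.PerpetualPump.CircuitTrace`. No `sorry` of its own; its
axiom closure contains `sorryAx` exactly through the five `stub_*`. -/
theorem CircuitTrace_of :
    _root_.Summit.NavierStokesRegularity.NavierStokesRegularity.Theses.PerpetualPump.CircuitTrace :=
  circuitTrace_iff.mpr (circuitTrace_of_parts stub_trailGronwall stub_lateSparsity stub_valveBudget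
    stub_blockStaysQuiet stub_quietImpliesRegular)

end Summit.NavierStokesRegularity.NavierStokesRegularity.Cruxes.CircuitTrace.QuietValveBudget

end
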